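import Summits.CriticalPhenomena.PercolationContinuityZ3.Theorems.PercNearOneGluingNoHeavyLowerTailApexForestGluingAlgebra
import HarnessLib

/-!
# Kozma–Nitzan Conjecture 1 on APEX-FOREST graphs — the whole forest induction, machine-checked on the gluing recursion
# (`NoHeavyLowerTail` cell, stmt-CriticalPhenomena-4575; new-inequality factory seat `prim-ineq-gen-7`, gen 3)

Support file (`--supports stmt-CriticalPhenomena-4575`).  Pure real algebra over an inductive type of weighted rooted trees; no measure
theory, no named facts, no sorries.  Companion of `…ApexForestGluingAlgebra` (the two-block lemma / one induction step).

A rooted weighted tree with hub weights is built from single vertices (`leaf ρ rel`: hub-avoidance factor `ρ = 1 − w(v,b)`, relay flag)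
by attaching a child subtree to the root of an existing tree along an edge of weight `q` (`cons T' q T₁`) — every finite rooted tree with
edge weights, hub weights and relay marks arises this way.  The GLUING RECURSION computes, bottom-up,
* `g T` = P(the root's forest-cluster avoids the hub),  `h T` = P(… and contains no relay)   (`g (cons T' q T₁) = g T'·(1 − q(1 − g T₁))`, …),
* `vals T` = the list, over the relays `α` of `T`, of the pairs `(d_α, e_α)` = (P(α ↮ hub), P(α's cluster avoids the hub and contains the root)),
  transported through `cons` by `(d,e) ↦ (d − q(1 − g T₁)e, e·(1 − q(1−g T₁)))` on the root side and `(d,e) ↦ (d − q(1 − g T')e, e·q·g T')` on the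
  child side (a relay loses exactly `e·P(edge open)·P(other side touches the hub)`),
which are the percolation quantities of the apex-forest instance by three elementary cluster facts and the independence of the two sides of a
forest edge (paper proof: run/shared/lean/prim/prim-ineq-gen-7/PROOF-CONJ1-APEXFOREST.md; that identification is NOT formalised here).
THEOREM `ApexForestRec.gluing_le`: for every such tree with parameters in `[0,1]`,
      `g T − h T ≤ d · (1 − h T)`  for some relay value `(d, e) ∈ vals T`  (when `T` has a relay; else `g T = h T`),
i.e. `P(o ↔ A, o ↮ b) ≤ max_a P(a ↮ b) · P(o ↔ A ∪ {b})` — Kozma–Nitzan's Conjecture 1 in its `A ∪ {b}` form — on every apex-forest graph,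
uniformly in the number of relays, the depth and the branching.  The proof is structural induction with `ApexForestAlgebra.step_certificate`,
carrying the invariant `0 ≤ e ≤ g − h`, `0 ≤ d ≤ 1` for every relay value and a certificate `g − h ≤ d(1 − h)` for one of them.
[cite: KozmaNitzan2024, Conjecture 1 (p. 3, (1))]
-/

namespace Summit.CriticalPhenomena.PercolationContinuityZ3.Theorems

namespace ApexForestRec

/-- Rooted trees with hub-avoidance factors at the vertices, relay flags, and edge weights: a single vertex, or a tree with one more
child subtree attached to its root. [this file] -/
inductive RT : Type
  | leaf (ρ : ℝ) (rel : Bool) : RT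
  | cons (T' : RT) (q : ℝ) (T₁ : RT) : RT

namespace RT

/-- All parameters in `[0,1]`. [this file] -/
def wf : RT → Prop
  | leaf ρ _ => 0 ≤ ρ ∧ ρ ≤ 1
  | cons T' q T₁ => wf T' ∧ (0 ≤ q ∧ q ≤ 1) ∧ wf T₁

/-- `g T` = P(the root's forest-cluster avoids the hub) (gluing recursion). [this file] -/
def g : RT → ℝ
  | leaf ρ _ => ρ
  | cons T' q T₁ => g T' * (1 - q * (1 - g T₁))

/-- `h T` = P(the root's forest-cluster avoids the hub and contains no relay). [this file] -/
def h : RT → ℝ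
  | leaf ρ rel => if rel then 0 else ρ
  | cons T' q T₁ => h T' * (1 - q * (1 - h T₁))

/-- The relay values `(d_α, e_α)` = (P(α ↮ hub), P(α's cluster avoids the hub and contains the root)), transported through the recursion.
[this file] -/
def vals : RT → List (ℝ × ℝ)
  | leaf ρ rel => if rel then [(ρ, ρ)] else []
  | cons T' q T₁ =>
      (vals T').map (fun p => (p.1 - q * (1 - g T₁) * p.2, p.2 * (1 - q * (1 - g T₁)))) ++
        (vals T₁).map (fun p => (p.1 - q * (1 - g T') * p.2, p.2 * q * g T'))

end RT

open RT

/-- Basic bounds: `0 ≤ h ≤ g ≤ 1`. [this file] -/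
theorem bounds : ∀ T : RT, T.wf → 0 ≤ T.h ∧ T.h ≤ T.g ∧ T.g ≤ 1
  | .leaf ρ rel, hw => by
      rcases hw with ⟨h0, h1⟩
      cases rel <;> simp [RT.g, RT.h, h0, h1]
  | .cons T' q T₁, hw => by
      rcases hw with ⟨hw', ⟨hq0, hq1⟩, hw₁⟩
      obtain ⟨h0', hhg', hg1'⟩ := bounds T' hw'
      obtain ⟨h0₁, hhg₁, hg1₁⟩ := bounds T₁ hw₁
      simp only [RT.g, RT.h]
      have hH0 : 0 ≤ 1 - q * (1 - T₁.h) := by nlinarith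
      have hHG : 1 - q * (1 - T₁.h) ≤ 1 - q * (1 - T₁.g) := by nlinarith
      have hG1 : 1 - q * (1 - T₁.g) ≤ 1 := by nlinarith
      refine ⟨mul_nonneg h0' hH0, ?_, ?_⟩
      · calc T'.h * (1 - q * (1 - T₁.h)) ≤ T'.g * (1 - q * (1 - T₁.h)) := mul_le_mul_of_nonneg_right hhg' hH0
          _ ≤ T'.g * (1 - q * (1 - T₁.g)) := mul_le_mul_of_nonneg_left hHG (le_trans h0' hhg')
      · calc T'.g * (1 - q * (1 - T₁.g)) ≤ 1 * 1 :=
            mul_le_mul hg1' hG1 (le_trans hH0 hHG) zero_le_one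
          _ = 1 := one_mul 1

/-- Without relays the two avoidance probabilities coincide: `vals T = [] → g T = h T`. [this file] -/
theorem g_eq_h_of_vals_nil : ∀ T : RT, T.vals = [] → T.g = T.h
  | .leaf ρ rel, hv => by
      cases rel
      · simp [RT.g, RT.h]
      · simp [RT.vals] at hv
  | .cons T' q T₁, hv => by
      simp only [RT.vals, List.append_eq_nil_iff, List.map_eq_nil_iff] at hv
      simp only [RT.g, RT.h, g_eq_h_of_vals_nil T' hv.1, g_eq_h_of_vals_nil T₁ hv.2]

/-- The invariant of every relay value: `0 ≤ e ≤ g − h` and `e ≤ d ≤ 1`. [this file] -/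
theorem vals_bounds : ∀ T : RT, T.wf → ∀ p ∈ T.vals, 0 ≤ p.2 ∧ p.2 ≤ T.g - T.h ∧ p.2 ≤ p.1 ∧ p.1 ≤ 1
  | .leaf ρ rel, hw, p, hp => by
      rcases hw with ⟨h0, h1⟩
      cases rel
      · simp [RT.vals] at hp
      · simp [RT.vals] at hp
        subst hp
        simp [RT.g, RT.h, h0, h1]
  | .cons T' q T₁, hw, p, hp => by
      rcases hw with ⟨hw', ⟨hq0, hq1⟩, hw₁⟩
      obtain ⟨h0', hhg', hg1'⟩ := bounds T' hw'
      obtain ⟨h0₁, hhg₁, hg1₁⟩ := bounds T₁ hw₁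
      simp only [RT.vals, List.mem_append, List.mem_map] at hp
      simp only [RT.g, RT.h]
      have hG0 : 0 ≤ 1 - q * (1 - T₁.g) := by nlinarith
      have hG1 : 1 - q * (1 - T₁.g) ≤ 1 := by nlinarith
      rcases hp with ⟨p', hp', rfl⟩ | ⟨p₁, hp₁, rfl⟩
      · obtain ⟨he0, heX, hed, hd1⟩ := vals_bounds T' hw' p' hp'
        refine ⟨mul_nonneg he0 hG0, ?_, ?_, ?_⟩
        · -- e' G ≤ X_T = a G − b H = (a−b)G + b q (g₁ − h₁)·... ≥ (a-b) G
          nlinarith [mul_le_mul_of_nonneg_right heX hG0, mul_nonneg (mul_nonneg h0' hq0) (sub_nonneg.2 hhg₁)]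
        · -- e'(1 − q(1−g₁)) ≤ d' − q(1−g₁)e'  ⟸  e' ≤ d'
          nlinarith [mul_nonneg (mul_nonneg hq0 (sub_nonneg.2 hg1₁)) he0]
        · nlinarith [mul_nonneg (mul_nonneg hq0 (sub_nonneg.2 hg1₁)) he0]
      · obtain ⟨he0, heX, hed, hd1⟩ := vals_bounds T₁ hw₁ p₁ hp₁
        have ha0 : 0 ≤ T'.g := le_trans h0' hhg'
        refine ⟨by positivity, ?_, ?_, ?_⟩
        · -- e₁ q a ≤ a q (g₁−h₁) ≤ X_T
          have hH0 : 0 ≤ 1 - q * (1 - T₁.h) := by nlinarith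
          nlinarith [mul_le_mul_of_nonneg_left heX (mul_nonneg hq0 ha0), mul_nonneg (sub_nonneg.2 hhg') hH0]
        · -- e₁ q a ≤ d₁ − q(1−a) e₁ ⟸ e₁ q ≤ d₁ … e₁ q a + q (1-a) e₁ = q e₁ ≤ e₁ ≤ d₁
          nlinarith [mul_le_mul_of_nonneg_left hq1 he0]
        · nlinarith [mul_nonneg (mul_nonneg hq0 (by linarith : (0:ℝ) ≤ 1 - T'.g)) he0]

/-- **The gluing inequality on every apex-forest (Conjecture 1 in `A ∪ {b}` form), by structural induction**: if the tree has a relay,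
some relay value `(d, e) ∈ vals T` certifies `g T − h T ≤ d · (1 − h T)`; read probabilistically,
`P(o ↔ A, o ↮ b) ≤ P(α ↮ b) · P(o ↔ A ∪ {b}) ≤ max_a P(a ↮ b) · P(o ↔ A ∪ {b})`.
[cite: KozmaNitzan2024, Conjecture 1 (p. 3, (1))] -/
theorem gluing_le : ∀ T : RT, T.wf → T.vals ≠ [] → ∃ p ∈ T.vals, T.g - T.h ≤ p.1 * (1 - T.h)
  | .leaf ρ rel, hw, hne => by
      cases rel
      · simp [RT.vals] at hne
      · refine ⟨(ρ, ρ), by simp [RT.vals], ?_⟩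
        simp [RT.g, RT.h]
  | .cons T' q T₁, hw, hne => by
      rcases hw with ⟨hw', ⟨hq0, hq1⟩, hw₁⟩
      obtain ⟨h0', hhg', hg1'⟩ := bounds T' hw'
      obtain ⟨h0₁, hhg₁, hg1₁⟩ := bounds T₁ hw₁
      -- certificates of the two blocks (a real one if the block has a relay, a borrowed degenerate one otherwise)
      by_cases hv' : T'.vals = []
      · -- root block without relays: a = b; the child must carry the relay
        have hv₁ : T₁.vals ≠ [] := by
          intro h1; apply hne; simp [RT.vals, hv', h1]
        obtain ⟨p₁, hp₁, hc₁⟩ := gluing_le T₁ hw₁ hv₁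
        obtain ⟨he0, heX, hed, hd1⟩ := vals_bounds T₁ hw₁ p₁ hp₁
        have hab : T'.g = T'.h := g_eq_h_of_vals_nil T' hv'
        refine ⟨(p₁.1 - q * (1 - T'.g) * p₁.2, p₁.2 * q * T'.g), ?_, ?_⟩
        · simp only [RT.vals, List.mem_append, List.mem_map]
          exact Or.inr ⟨p₁, hp₁, rfl⟩
        · simp only [RT.g, RT.h]
          -- `step` with the degenerate root certificate (d', e') := (M, 0), M := the child's displaced value
          have hM0 : 0 ≤ p₁.1 - q * (1 - T'.g) * p₁.2 := by
            have h1 : q * (1 - T'.g) ≤ 1 := by nlinarith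
            have h2 : q * (1 - T'.g) * p₁.2 ≤ 1 * p₁.2 := mul_le_mul_of_nonneg_right h1 he0
            linarith
          have hX0 : T'.g - T'.h = 0 := by rw [hab]; ring
          have := ApexForestAlgebra.step T'.g T'.h T₁.g T₁.h q (p₁.1 - q * (1 - T'.g) * p₁.2)
            p₁.1 p₁.2 (p₁.1 - q * (1 - T'.g) * p₁.2) 0 h0' hhg' hg1' h0₁ hhg₁ hg1₁ hq0 hq1
            heX hc₁ le_rfl (by rw [hX0]) (by rw [hX0]; exact mul_nonneg hM0 (by linarith))
            (by simp)
          exact this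
      · by_cases hv₁ : T₁.vals = []
        · -- child without relays: g₁ = h₁; the root block carries the relay
          obtain ⟨p', hp', hc'⟩ := gluing_le T' hw' hv'
          obtain ⟨he0, heX, hed, hd1⟩ := vals_bounds T' hw' p' hp'
          have hgh : T₁.g = T₁.h := g_eq_h_of_vals_nil T₁ hv₁
          refine ⟨(p'.1 - q * (1 - T₁.g) * p'.2, p'.2 * (1 - q * (1 - T₁.g))), ?_, ?_⟩
          · simp only [RT.vals, List.mem_append, List.mem_map]
            exact Or.inl ⟨p', hp', rfl⟩
          · simp only [RT.g, RT.h]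
            have hM0 : 0 ≤ p'.1 - q * (1 - T₁.g) * p'.2 := by
              have h1 : q * (1 - T₁.g) ≤ 1 := by nlinarith
              have h2 : q * (1 - T₁.g) * p'.2 ≤ 1 * p'.2 := mul_le_mul_of_nonneg_right h1 he0
              linarith
            have hX0 : T₁.g - T₁.h = 0 := by rw [hgh]; ring
            have := ApexForestAlgebra.step T'.g T'.h T₁.g T₁.h q (p'.1 - q * (1 - T₁.g) * p'.2)
              (p'.1 - q * (1 - T₁.g) * p'.2) 0 p'.1 p'.2 h0' hhg' hg1' h0₁ hhg₁ hg1₁ hq0 hq1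
              (by rw [hX0]) (by rw [hX0]; exact mul_nonneg hM0 (by linarith)) (by simp)
              heX hc' le_rfl
            exact this
        · -- both blocks carry relays: `step_certificate`
          obtain ⟨p', hp', hc'⟩ := gluing_le T' hw' hv'
          obtain ⟨he0', heX', hed', hd1'⟩ := vals_bounds T' hw' p' hp'
          obtain ⟨p₁, hp₁, hc₁⟩ := gluing_le T₁ hw₁ hv₁
          obtain ⟨he0₁, heX₁, hed₁, hd1₁⟩ := vals_bounds T₁ hw₁ p₁ hp₁
          have key := (ApexForestAlgebra.step_certificate T'.g T'.h T₁.g T₁.h q p₁.1 p₁.2 p'.1 p'.2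
            h0' hhg' hg1' h0₁ hhg₁ hg1₁ hq0 hq1 he0₁ heX₁ hc₁ he0' heX' hc').2.2
          rcases le_total (p₁.1 - q * (1 - T'.g) * p₁.2) (p'.1 - q * (1 - T₁.g) * p'.2) with hle | hle
          · refine ⟨(p'.1 - q * (1 - T₁.g) * p'.2, p'.2 * (1 - q * (1 - T₁.g))), ?_, ?_⟩
            · simp only [RT.vals, List.mem_append, List.mem_map]; exact Or.inl ⟨p', hp', rfl⟩
            · simp only [RT.g, RT.h]; rw [max_eq_right hle] at key; exact key
          · refine ⟨(p₁.1 - q * (1 - T'.g) * p₁.2, p₁.2 * q * T'.g), ?_, ?_⟩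
            · simp only [RT.vals, List.mem_append, List.mem_map]; exact Or.inr ⟨p₁, hp₁, rfl⟩
            · simp only [RT.g, RT.h]; rw [max_eq_left hle] at key; exact key

end ApexForestRec

end Summit.CriticalPhenomena.PercolationContinuityZ3.Theorems
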